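import Summits.SmoothPoincare4.SmoothPoincare4.Theses.WeakReductionDescent
import Literature.Topology.FourManifolds.WeaklyReducibleTrisections
import Summits.SmoothPoincare4.SmoothPoincare4.Theorems.WeakReductionDescentMinimalWeaklyReducibleFromFourStubPigeonhole
import Summits.SmoothPoincare4.SmoothPoincare4.Theorems.WeakReductionDescentMinimalWeaklyReducibleFromFourStubTwoSided

/-!
# Crux `WeakReductionDescent.MinimalWeaklyReducibleFromFour` (stmt-SmoothPoincare4-18019), line `Sketch`
# (spine A = KCap, card `sector-haken-lemma-kcap`) — the REDUCTIONS, kernel-checked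

The crux X₂: every minimal GK-trisection of genus `g ≥ 4` of a smooth homotopy 4-sphere `M` (bare
binders + `e : M ≃ₕ S⁴`) is weakly reducible.  This file lands, sorry-free, the two transfers of the
line as closed implications into the crux BY NAME (registered helper stubs of the line's skeleton
`Cruxes/MinimalWeaklyReducibleFromFour/Lines/Sketch.lean`):

* `helper_fromFour_of_kcap` — **KCap ⇒ X₂**: if every GK-trisection of a smooth homotopy 4-sphere
  with some `k_p ≥ 2` is weakly reducible (`Trisection.IsWeaklyReducible`, Aranda–Zupan's notion),
  then X₂ holds.  Proof: `χ = 2` forces `g = k₀ + k₁ + k₂` (proved tree theorem), so `g ≥ 4`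
  gives a label with `k_p ≥ 2` (`stub_pigeonhole`, landed), and `Trisection.isWeaklyReducible_iff`
  is `Iff.rfl` to the crux clause.  Global minimality is not consumed: KCap is the minimality-free,
  unshielded strengthening of X₂ (it speaks about `S⁴`'s own trisections with a `k ≥ 2` label).
* `helper_kcap_of_sectorHaken` — **SectorHaken ⇒ KCap** by two-sidedness (`stub_twoSided`, landed):
  at a label `p` with `k_p ≥ 2`, a non-separating `p`-compressing curve `c` missing a separating
  curve `δ ⊆ F` that has `p`-cores `c₁`, `c₂` off it on different sides misses one of the cores,
  and `(c, cᵢ)` is a weak reduction.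
* `helper_fromFour_of_sectorHaken` — **SectorHaken ⇒ X₂**, the composition (= the skeleton theorem
  `MinimalWeaklyReducibleFromFour_of` with its one open stub `stub_sectorHaken` as hypothesis).

SectorHaken ("Haken's lemma for the third handlebody": some balanced separating reducing curve of
the non-prime sector boundary `∂X_p ≅ #^{k_p}(S¹ × S²)`, `k_p ≥ 2`, admits a disjoint
non-separating compressing curve of `H_p`) is the line's open apex; nothing here asserts it.

References: R. Aranda, A. Zupan, arXiv:2503.04607 (2025), §2 p. 6 (weakly reducible), Lemma 2.2
(Haken's lemma), Q8.3; J. Meier, T. Schirmer, A. Zupan, arXiv:1507.06561, Remark 3.12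
(`g = Σ kᵢ` for `S⁴`), Question 3.6; D. Gay, R. Kirby, Geom. Topol. 20 (2016), Def. 1, Remark 2.
-/

open scoped Manifold ContDiff Topology ContinuousMap
open Set
open Literature.Topology.FourManifolds
open Summit.SmoothPoincare4.SmoothPoincare4.Theses.WeakReductionDescent

namespace Summit.SmoothPoincare4.SmoothPoincare4.Theorems.MinimalWeaklyReducibleFromFour.KCap

set_option linter.dupNamespace false

/-- **KCap ⇒ X₂.** If every GK-trisection of a smooth homotopy 4-sphere with some `k_p ≥ 2` is
weakly reducible, then every (minimal) GK-trisection of genus `g ≥ 4` of a smooth homotopy 4-sphere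
is weakly reducible: `g = k₀ + k₁ + k₂ ≥ 4` gives a label with `k_p ≥ 2` (`stub_pigeonhole`), and
the crux clause is `Trisection.IsWeaklyReducible T` unfolded (`Trisection.isWeaklyReducible_iff`).
Minimality is not used. [cite: MeierSchirmerZupan2016, Remark 3.12] -/
theorem helper_fromFour_of_kcap : (∀ (M : Type) [TopologicalSpace M] [T2Space M] [SecondCountableTopology M] [ChartedSpace (EuclideanSpace ℝ (Fin 4)) M] [IsManifold (𝓡 4) ((⊤ : ℕ∞) : WithTop ℕ∞) M], (M ≃ₕ (Metric.sphere (0 : EuclideanSpace ℝ (Fin 5)) 1)) → ∀ (g : ℕ) (k : Fin 3 → ℕ) (T : Fin 3 → Set M), Literature.Topology.FourManifolds.IsGKTrisection M g k T → (∃ p : Fin 3, 2 ≤ k p) → Literature.Topology.FourManifolds.Trisection.IsWeaklyReducible T) → Summit.SmoothPoincare4.SmoothPoincare4.Theses.WeakReductionDescent.MinimalWeaklyReducibleFromFour := by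
  intro hK M _ _ _ _ _ e g k T hT hg _hmin
  exact (Trisection.isWeaklyReducible_iff T).1 (hK M e g k T hT (stub_pigeonhole M e g k T hT hg))

/-- **SectorHaken ⇒ KCap** (two-sidedness, `stub_twoSided`): at a label `p` with `k_p ≥ 2`, the
non-separating `p`-compressing curve `c ⊆ F ∖ δ` supplied by SectorHaken misses one of the two
`p`-cores `c₁`, `c₂` lying off `δ` on different sides of it, and is a weak reduction with it.
[cite: ArandaZupan2025, §2 (p. 6)] -/
theorem helper_kcap_of_sectorHaken : (∀ (M : Type) [TopologicalSpace M] [T2Space M] [SecondCountableTopology M] [ChartedSpace (EuclideanSpace ℝ (Fin 4)) M] [IsManifold (𝓡 4) ((⊤ : ℕ∞) : WithTop ℕ∞) M], (M ≃ₕ (Metric.sphere (0 : EuclideanSpace ℝ (Fin 5)) 1)) → ∀ (g : ℕ) (k : Fin 3 → ℕ) (T : Fin 3 → Set M), Literature.Topology.FourManifolds.IsGKTrisection M g k T → 4 ≤ g → ∀ (p : Fin 3), 2 ≤ k p → ∃ (δ c₁ c₂ c : Set M), Literature.Topology.FourManifolds.Trisection.IsCurve T δ ∧ (∀ q : Fin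 3, q ≠ p → Literature.Topology.FourManifolds.Trisection.BoundsDisc T (Literature.Topology.FourManifolds.Trisection.spineHandlebody T q) δ) ∧ (Literature.Topology.FourManifolds.Trisection.IsCurve T c₁ ∧ Literature.Topology.FourManifolds.Trisection.IsNonSeparating T c₁ ∧ ∀ q : Fin 3, q ≠ p → Literature.Topology.FourManifolds.Trisection.BoundsDisc T (Literature.Topology.FourManifolds.Trisection.spineHandlebody T q) c₁) ∧ (Literature.Topology.FourManifolds.Trisection.IsCurve T c₂ ∧ Literature.Topology.FourManifolds.Trisection.IsNonSeparating T c₂ ∧ ∀ q : Fin 3, q ≠ p → Literature.Topology.FourManifolds.Trisection.BoundsDisc T (Literature.Topology.FourManifolds.Trisection.spineHandlebody T q) c₂) ∧ Disjoint c₁ δ ∧ Disjoint c₂ δ ∧ (∀ S : Set M, S ⊆ Literature.Topology.FourManifolds.Trisection.centralSurfaceSet T \ δ → IsPreconnected S → c₁ ⊆ S → c₂ ⊆ S → False) ∧ Literature.Topology.FourManifolds.Trisection.IsCurve T c ∧ Literature.Topology.FourManifolds.Trisection.IsNonSeparating T c ∧ Literature.Topology.FourManifolds.Trisection.BoundsDisc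 T (Literature.Topology.FourManifolds.Trisection.spineHandlebody T p) c ∧ Disjoint c δ) → (∀ (M : Type) [TopologicalSpace M] [T2Space M] [SecondCountableTopology M] [ChartedSpace (EuclideanSpace ℝ (Fin 4)) M] [IsManifold (𝓡 4) ((⊤ : ℕ∞) : WithTop ℕ∞) M], (M ≃ₕ (Metric.sphere (0 : EuclideanSpace ℝ (Fin 5)) 1)) → ∀ (g : ℕ) (k : Fin 3 → ℕ) (T : Fin 3 → Set M), Literature.Topology.FourManifolds.IsGKTrisection M g k T → 4 ≤ g → ∀ (p : Fin 3), 2 ≤ k p → Literature.Topology.FourManifolds.Trisection.IsWeaklyReducible T) := by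
  intro hSH M _ _ _ _ _ e g k T hT hg p hp
  obtain ⟨δ, c₁, c₂, c, -, -, hc₁, hc₂, hd₁, hd₂, hsides, hc, hcns, hcp, hcδ⟩ :=
    hSH M e g k T hT hg p hp
  exact stub_twoSided M T p δ c₁ c₂ c hc₁ hc₂ hd₁ hd₂ hsides hc hcns hcp hcδ

/-- **SectorHaken ⇒ X₂** (the line's composition: pigeonhole → SectorHaken → two-sidedness →
`Iff.rfl`).  With SectorHaken proved this closes the crux by one application. [cite: ArandaZupan2025, Lemma 2.2 and §2 (p. 6)] -/
theorem helper_fromFour_of_sectorHaken : (∀ (M : Type) [TopologicalSpace M] [T2Space M] [SecondCountableTopology M] [ChartedSpace (EuclideanSpace ℝ (Fin 4)) M] [IsManifold (𝓡 4) ((⊤ : ℕ∞) : WithTop ℕ∞) M], (M ≃ₕ (Metric.sphere (0 : EuclideanSpace ℝ (Fin 5)) 1)) → ∀ (g : ℕ) (k : Fin 3 → ℕ) (T : Fin 3 → Set M), Literature.Topology.FourManifolds.IsGKTrisection M g k T → 4 ≤ g → ∀ (p : Fin 3), 2 ≤ k p → ∃ (δ c₁ c₂ c : Set M), Literature.Topology.FourManifolds.Trisection.IsCurve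 T δ ∧ (∀ q : Fin 3, q ≠ p → Literature.Topology.FourManifolds.Trisection.BoundsDisc T (Literature.Topology.FourManifolds.Trisection.spineHandlebody T q) δ) ∧ (Literature.Topology.FourManifolds.Trisection.IsCurve T c₁ ∧ Literature.Topology.FourManifolds.Trisection.IsNonSeparating T c₁ ∧ ∀ q : Fin 3, q ≠ p → Literature.Topology.FourManifolds.Trisection.BoundsDisc T (Literature.Topology.FourManifolds.Trisection.spineHandlebody T q) c₁) ∧ (Literature.Topology.FourManifolds.Trisection.IsCurve T c₂ ∧ Literature.Topology.FourManifolds.Trisection.IsNonSeparating T c₂ ∧ ∀ q : Fin 3, q ≠ p → Literature.Topology.FourManifolds.Trisection.BoundsDisc T (Literature.Topology.FourManifolds.Trisection.spineHandlebody T q) c₂) ∧ Disjoint c₁ δ ∧ Disjoint c₂ δ ∧ (∀ S : Set M, S ⊆ Literature.Topology.FourManifolds.Trisection.centralSurfaceSet T \ δ → IsPreconnected S → c₁ ⊆ S → c₂ ⊆ S → False) ∧ Literature.Topology.FourManifolds.Trisection.IsCurve T c ∧ Literature.Topology.FourManifolds.Trisection.IsNonSeparating T c ∧ Literature.Topology.FourManifolds.Trisection.BoundsDisc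 T (Literature.Topology.FourManifolds.Trisection.spineHandlebody T p) c ∧ Disjoint c δ) → Summit.SmoothPoincare4.SmoothPoincare4.Theses.WeakReductionDescent.MinimalWeaklyReducibleFromFour := by
  intro hSH M _ _ _ _ _ e g k T hT hg _hmin
  obtain ⟨p, hp⟩ := stub_pigeonhole M e g k T hT hg
  exact (Trisection.isWeaklyReducible_iff T).1 (helper_kcap_of_sectorHaken hSH M e g k T hT hg p hp)

end Summit.SmoothPoincare4.SmoothPoincare4.Theorems.MinimalWeaklyReducibleFromFour.KCap
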